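import Summits.BirchSwinnertonDyer.BirchSwinnertonDyer.Theorems.PrintCFramBottomClassIndexLawFiveLeFlipRungModularVehicle
import Summits.BirchSwinnertonDyer.BirchSwinnertonDyer.Theorems.PrintCFramBottomClassIndexLawFiveLeFlipRungModularOmega
import Summits.BirchSwinnertonDyer.BirchSwinnertonDyer.Theorems.PrintCFramBottomClassIndexLawFiveLeFlipRungSlashCoeff
import Summits.BirchSwinnertonDyer.BirchSwinnertonDyer.Theorems.PrintCFramBottomClassIndexLawFiveLeFlipRungModularInput
import Summits.BirchSwinnertonDyer.BirchSwinnertonDyer.Theorems.PrintCFramBottomClassIndexLawFiveLeFlipRungFourierSlashGlue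
import Summits.BirchSwinnertonDyer.BirchSwinnertonDyer.Theorems.PrintCFramBottomClassIndexLawFiveLeFlipRungTransportReading
import Summits.BirchSwinnertonDyer.BirchSwinnertonDyer.Theorems.PrintCFramBottomClassIndexLawFiveLeFlipRungOfJML
import HarnessLib

set_option autoImplicit false

/-!
# Crux `PrintCFram.BottomClassIndexLawFiveLe` (stmt-BirchSwinnertonDyer-20372), line `eisenstein-resource-bdp-line` (registry v27/v28):
# the typing of `stub_flipRung`, modular assembly, part 3 — `jml_six_of_facts : NF-A → NF-Q → (JML⁶)`
# (cell `bsd-print-cfram`, width seat `bsd-line-cfram-p1-w4` g19 (cusp half) with `bsd-line-cfram-p1-w3` g19 (input half);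
# THEOREMS ONLY, `--supports` 20372; BSD is not proved by any of this)

HONEST FRAMING. Nothing here is a statement about elliptic curves or BSD; no registered stub is closed by this file alone. CONDITIONAL
on the two cite-only named facts NF-A (`Cohen1975.thm31_cohenSeries_mem_halfIntModularForms`, Cohen 1975 Thm 3.1) and NF-Q
(`Katz1973_qExpansionPrinciple_allCusps`, Katz 1973 Cor. 1.6.2), taken as hypotheses. It proves w8 g9's JOINT MODULAR LEMMA (JML⁶)
(= the `hJML` binder of `FlipRung.rung_six_of_jml`, p709047, VERBATIM) — the single interface between the modular side of LEAD g14's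
flipped-cusp rung and the Bernoulli side: for every class datum, sign pattern `τ`, odd prime `q ∣ m` with `q* ≢ 1 (mod p)`, `σ = ±1`
and the away-from-`q` cut `a = 𝟙_AWAY·H_k` of Cohen's numbers, there are `N, D, Θ, w` such that «the class-`σ` coefficients of
`mk a * Θ` lie in `p·ℤ̄[1/N]`» implies «the class-`−σ` coefficients times `w` lie in `p·ℤ̄[1/N]`». With `rung_six_of_jml` (w8 g9) and
`flipRung_six_of_rung` (p707470) this gives `(FlipRung⁶)` from NF-A ∧ NF-Q, i.e. discharges `stub_flipRung` up to LEAD's registry edit.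

THE CHAIN (all by name): period `Q₀` of the away-cut prime to `pq` (w8 g9 `awayCut_add_iff`); vehicle `g` = cut of `H_k·θ((qQ₀)²·)`
with `hinv` (`exists_flipVehicle_of_periodic`, (G3)); cusp matrix `ω₀` and unit solutions `y, c` (`exists_flippedCusp_matrix`,
`exists_unit_solutions`); the Legendre twist `V_σ` with its coefficients at EVERY cusp in `p·ℤ̄[1/N]` (w3 g19
`exists_twist_forall_coeff_slash_mem_nat`, calling NF-Q); the coefficient of `e(u w/q³)` at `ω₀` (T3 (D) `coeff_flippedCusp_eq`, with
w3 g19 `hasSum_qExpansion_slash_of_gamma1` and w6 g9 `flipMoment_cexp_eq_zero_of_not_dvd`); its value on the class `−σ`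
(w6 g9 `flipMoment_cexp_mul_eq`, `one_add_flipWeight_eq`: weight `(q/2)(1 − q·J(−1|q))`); the reading `w := 1 − q·J(−1|q)`,
`N := 4(qQ₀)²Q₀²q⁴`, `D := (qQ₀)²`. beyond-print theorem: NO.

References: [Cohen1975] Thm. 3.1; [Katz1973] §1.6 Cor. 1.6.2; [Shimura1971] Prop. 3.64; crux notes lead-g14 §2.1–§2.5.
-/

-- summit-side namespace `Summit.BirchSwinnertonDyer.BirchSwinnertonDyer.…` (single-conjunct summit, D-0017 layout)
set_option linter.dupNamespace false

noncomputable section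

open scoped MatrixGroups ModularForm Real Classical NumberTheorySymbols
open UpperHalfPlane hiding I
open Complex CongruenceSubgroup Function PowerSeries
open Literature.NumberTheory.EllipticCurves.ModularForms
open Literature.NumberTheory.EllipticCurves.Tunnell1983
open Literature.NumberTheory.ModularForms
open Literature.NumberTheory.ModularForms.CohenEisenstein (cohenH)

namespace Summit.BirchSwinnertonDyer.BirchSwinnertonDyer.Theorems.PrintCFram.FlipRung

/-! ## §1 Small arithmetic sockets -/

/-- The normalising unit of the reading: `(q²)⁻¹·(q²)^{−(k+1)}·(q/2)·(2·q^{2k+3}) = 1`. [folklore] -/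
theorem flipConstant_mul_eq_one {q : ℂ} (hq : q ≠ 0) (k : ℕ) :
    (q ^ 2)⁻¹ * (q ^ 2) ^ (-((k + 1 : ℕ) : ℤ)) * (q / 2) * (2 * q ^ (2 * k + 3)) = 1 := by
  rw [zpow_neg, zpow_natCast]
  field_simp
  ring

/-- `w = 1 − q·J(−1|q)` is a non-zero integer for `q ≥ 2`. [folklore] -/
theorem one_sub_mul_jacobiSym_ne_zero {q : ℕ} (hq : 2 ≤ q) : (1 : ℤ) - q * J(-1 | q) ≠ 0 := by
  intro h
  have h1 : (q : ℤ) ∣ 1 := ⟨J(-1 | q), by linear_combination h⟩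
  have := Int.eq_one_of_dvd_one (by positivity) h1
  omega

/-! ## §2 The joint modular lemma from NF-A and NF-Q -/

/-- **(JML⁶) FROM THE TWO CITED FACTS — `jml_six_of_facts : NF-A → NF-Q → (JML⁶)`** (the `hJML` binder of w8 g9's
`FlipRung.rung_six_of_jml`, VERBATIM). For a class datum `(p, m, χ, k)`, a sign pattern `τ`, an odd prime `q ∣ m` with
`¬ p ∣ q·J(−1|q) − 1`, `σ = ±1`, and the away-from-`q` cut `a` of Cohen's numbers (`a = H(k,·)` on AWAY, `0` off it), we exhibit
`N = 4(qQ₀)²Q₀²q⁴` (`Q₀` a period of AWAY prime to `pq`), `D = (qQ₀)²`, `Θ` = the coefficients of `θ((qQ₀)²·)`, `w = 1 − q·J(−1|q)`,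
and prove: if the class-`σ` coefficients `((mk a * Θ) n : ℚ)`, `q ∥ n`, `J(n/q|q) = σ`, lie in `p·ℤ̄[1/N]`, then for every `n` with `q ∥ n`,
`J(n/q|q) = −σ`, `((mk a * Θ) n · w : ℚ) ∈ p·ℤ̄[1/N]`. Mechanism: the vehicle `g` (cut of `H_k·θ((qQ₀)²·)`, invariant under
`Γ₀(4Q₀⁴q²) ⊓ Γ₁(4Q₀⁴)`), its Legendre twist `V_σ` (coefficients at EVERY cusp in `p·ℤ̄[1/N]` by Katz's principle), and the coefficient of
`e(u w/q³)` at the flipped cusp `ω₀`: `(q²)⁻¹(q²)^{−(k+1)}·(mk a * Θ)(qu)·(q/2)(1 − q·J(−1|q))` on the class `−σ` (T3 (D) + T1).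
CONDITIONAL on NF-A and NF-Q (hypotheses); closes no stub by itself. [cite: Cohen1975, Thm. 3.1] [cite: Katz1973, §1.6 Cor. 1.6.2]
[cite: Shimura1971, Prop. 3.64] -/
theorem jml_six_of_facts (hA : Cohen1975.thm31_cohenSeries_mem_halfIntModularForms)
    (hKatz : Literature.NumberTheory.ModularForms.Katz1973_qExpansionPrinciple_allCusps) :
    ∀ (p : ℕ) [Fact p.Prime] (m : ℕ) [NeZero m] (χ : DirichletCharacter ℚ_[p] m) (k : ℕ),
      (p = 7 ∨ p = 11 ∨ p = 19 ∨ p = 43 ∨ p = 67 ∨ p = 163) →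
      m.Coprime p → χ.IsPrimitive → χ.IsQuadratic → (k = (p + 1) / 4 ∨ k = (3 * p - 1) / 4) →
      2 ≤ k → k ≤ p - 2 → χ (-1) * (-1) ^ k = -1 →
      ∀ (τ : ℕ → ℤ) (q : ℕ), q.Prime → q ∣ m → q ≠ 2 →
      (∀ q' : ℕ, q'.Prime → q' ∣ m → q' ≠ 2 → (τ q' = 1 ∨ τ q' = -1)) →
      ¬ ((p : ℤ) ∣ (q : ℤ) * jacobiSym (-1) q - 1) →
      ∀ (σ : ℤ), (σ = 1 ∨ σ = -1) → ∀ (a : ℕ → ℚ),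
      (∀ i : ℕ, (m / q ∣ i ∧ i / (m / q) % 4 = 3 * q % 4 ∧
          (∀ q' : ℕ, q'.Prime → q' ∣ m / q → q' ≠ 2 →
            jacobiSym (-((i / (m / q) : ℕ) : ℤ)) q' = τ q' * jacobiSym (q : ℤ) q') ∧
          (2 ∣ m → i / (m / q) % 8 = 7 * q % 8) ∧ (q ≠ 3 → ¬ 3 ∣ i / (m / q))) → a i = cohenH k i) →
      (∀ i : ℕ, ¬ (m / q ∣ i ∧ i / (m / q) % 4 = 3 * q % 4 ∧
          (∀ q' : ℕ, q'.Prime → q' ∣ m / q → q' ≠ 2 →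
            jacobiSym (-((i / (m / q) : ℕ) : ℤ)) q' = τ q' * jacobiSym (q : ℤ) q') ∧
          (2 ∣ m → i / (m / q) % 8 = 7 * q % 8) ∧ (q ≠ 3 → ¬ 3 ∣ i / (m / q))) → a i = 0) →
      ∃ (N D : ℕ) (Θ : PowerSeries ℕ) (w : ℚ), ¬ p ∣ N ∧ 2 ∣ N ∧ q ^ 2 ∣ D ∧
        Function.Periodic (fun i : ℕ => (m / q ∣ i ∧ i / (m / q) % 4 = 3 * q % 4 ∧
          (∀ q' : ℕ, q'.Prime → q' ∣ m / q → q' ≠ 2 →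
            jacobiSym (-((i / (m / q) : ℕ) : ℤ)) q' = τ q' * jacobiSym (q : ℤ) q') ∧
          (2 ∣ m → i / (m / q) % 8 = 7 * q % 8) ∧ (q ≠ 3 → ¬ 3 ∣ i / (m / q)))) D ∧
        PowerSeries.coeff 0 Θ = 1 ∧ (∀ j : ℕ, PowerSeries.coeff j Θ ≠ 0 → D ∣ j) ∧ w ≠ 0 ∧ padicValRat p w = 0 ∧
        ((∀ n : ℕ, q ∣ n → ¬ q ^ 2 ∣ n → jacobiSym ((n / q : ℕ) : ℤ) q = σ →
            ∃ y : ℂ, (∃ j : ℕ, IsIntegral ℤ ((N : ℂ) ^ j * y)) ∧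
              ((PowerSeries.coeff n (PowerSeries.mk a * PowerSeries.map (Nat.castRingHom ℚ) Θ) : ℚ) : ℂ) = (p : ℂ) * y) →
          ∀ n : ℕ, q ∣ n → ¬ q ^ 2 ∣ n → jacobiSym ((n / q : ℕ) : ℤ) q = -σ →
            ∃ y : ℂ, (∃ j : ℕ, IsIntegral ℤ ((N : ℂ) ^ j * y)) ∧
              ((PowerSeries.coeff n (PowerSeries.mk a * PowerSeries.map (Nat.castRingHom ℚ) Θ) * w : ℚ) : ℂ) =
                (p : ℂ) * y) := by
  intro p _ m _ χ k hp6 hmp hχ hχq _ hk _ _ τ q hq hqm hq2 _ hstar σ hσ a ha_on ha_off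
  -- the away-cut predicate
  set AWAY : ℕ → Prop := fun i : ℕ => (m / q ∣ i ∧ i / (m / q) % 4 = 3 * q % 4 ∧
    (∀ q' : ℕ, q'.Prime → q' ∣ m / q → q' ≠ 2 →
      jacobiSym (-((i / (m / q) : ℕ) : ℤ)) q' = τ q' * jacobiSym (q : ℤ) q') ∧
    (2 ∣ m → i / (m / q) % 8 = 7 * q % 8) ∧ (q ≠ 3 → ¬ 3 ∣ i / (m / q))) with hAWAY
  -- basic arithmetic
  have hp : p.Prime := Fact.out
  have hp7 : 7 ≤ p := by rcases hp6 with h | h | h | h | h | h <;> omega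
  haveI : Fact q.Prime := ⟨hq⟩
  have hq0 : q ≠ 0 := hq.ne_zero
  haveI : NeZero (q ^ 2) := ⟨pow_ne_zero 2 hq0⟩
  have hm0 : m ≠ 0 := NeZero.ne m
  have hqm2 : ¬ q ^ 2 ∣ m := not_sq_dvd_conductor_of_odd_prime hχ hχq hq hq2 hqm
  have hmq : m = q * (m / q) := (Nat.mul_div_cancel' hqm).symm
  have hmq0 : 0 < m / q := Nat.div_pos (Nat.le_of_dvd (Nat.pos_of_ne_zero hm0) hqm) hq.pos
  have hqmq : ¬ q ∣ m / q := fun h ↦ hqm2 (by rw [hmq, pow_two]; exact Nat.mul_dvd_mul_left q h)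
  have hpm : ¬ p ∣ m := fun h ↦ hp.one_lt.ne' (Nat.Coprime.eq_one_of_dvd hmp.symm h)
  have hpmq : ¬ p ∣ m / q := fun h ↦ hpm (h.trans (Nat.div_dvd_of_dvd hqm))
  have hpq : p ≠ q := by rintro rfl; exact hpm hqm
  -- a period `Q₀` of AWAY prime to `p q`
  set c₃ : ℕ := if q = 3 then 1 else 3 with hc₃
  set Q₀ : ℕ := (m / q) * (8 * (m / q) * c₃) with hQ₀def
  have hc₃0 : 0 < c₃ := by rw [hc₃]; split_ifs <;> norm_num
  have hQ₀ : 0 < Q₀ := by positivity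
  haveI : NeZero Q₀ := ⟨hQ₀.ne'⟩
  have hqc₃ : ¬ q ∣ c₃ := by
    rw [hc₃]; split_ifs with h
    · exact fun hd => hq.one_lt.ne' (Nat.dvd_one.mp hd)
    · intro hd; exact h ((Nat.prime_dvd_prime_iff_eq hq Nat.prime_three).mp hd)
  have hq8 : ¬ q ∣ 8 := by
    intro h
    have h2 : q ∣ 2 := hq.dvd_of_dvd_pow (show q ∣ 2 ^ 3 by simpa using h)
    exact hq2 ((Nat.prime_dvd_prime_iff_eq hq Nat.prime_two).mp h2)
  have hqQ₀ : ¬ q ∣ Q₀ := by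
    intro hd
    rcases (Nat.Prime.dvd_mul hq).mp hd with h | h
    · exact hqmq h
    rcases (Nat.Prime.dvd_mul hq).mp h with h | h
    · rcases (Nat.Prime.dvd_mul hq).mp h with h | h
      · exact hq8 h
      · exact hqmq h
    · exact hqc₃ h
  have hpc₃ : ¬ p ∣ c₃ := by
    rw [hc₃]; split_ifs
    · exact fun hd => hp.one_lt.ne' (Nat.dvd_one.mp hd)
    · intro hd
      have := (Nat.prime_dvd_prime_iff_eq hp Nat.prime_three).mp hd
      omega
  have hp8 : ¬ p ∣ 8 := by
    intro h
    have h2 : p ∣ 2 := hp.dvd_of_dvd_pow (show p ∣ 2 ^ 3 by simpa using h)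
    have := (Nat.prime_dvd_prime_iff_eq hp Nat.prime_two).mp h2
    omega
  have hpQ₀ : ¬ p ∣ Q₀ := by
    intro hd
    rcases (Nat.Prime.dvd_mul hp).mp hd with h | h
    · exact hpmq h
    rcases (Nat.Prime.dvd_mul hp).mp h with h | h
    · rcases (Nat.Prime.dvd_mul hp).mp h with h | h
      · exact hp8 h
      · exact hpmq h
    · exact hpc₃ h
  have hper : Function.Periodic AWAY Q₀ := by
    intro n
    have h := awayCut_add_iff m (m / q) q τ (8 * (m / q) * c₃) n 1 hmq0 ⟨(m / q) * c₃, by ring⟩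
      (fun q' _ hqm' => Dvd.dvd.mul_right (Dvd.dvd.mul_left hqm' 8) c₃)
      (fun hq3 => ⟨8 * (m / q), by rw [hc₃, if_neg hq3]; ring⟩)
    rw [mul_one] at h
    rw [hAWAY]
    exact propext h
  -- the vehicle `g` (cut of `H_k · θ((qQ₀)²·)`) with `hinv`
  obtain ⟨g, Θ, b, hΘ0, hΘsupp, -, hgq, hinv⟩ := exists_flipVehicle_of_periodic hA hk (q := q) (Q₀ := Q₀) hq.pos AWAY hper
  -- its rational coefficients are `mk a * Θ`
  have ha : (fun i : ℕ ↦ if AWAY i then cohenH k i else 0) = a := by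
    funext i
    by_cases h : AWAY i
    · rw [if_pos h, ha_on i h]
    · rw [if_neg h, ha_off i h]
  have hc : ∀ n : ℕ, (qExpansion 1 ⇑g).coeff n =
      (((PowerSeries.coeff n (PowerSeries.mk a * PowerSeries.map (Nat.castRingHom ℚ) Θ)) : ℚ) : ℂ) := by
    intro n; rw [hgq n, ha]
  -- the cusp matrix and the unit solutions, `M = 4 Q₀⁴`
  have hcopM : Nat.Coprime q (4 * Q₀ ^ 4) := by
    have h4 : Nat.Coprime q 4 := by
      have : Nat.Coprime q 2 := (Nat.coprime_primes hq Nat.prime_two).mpr hq2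
      simpa using this.pow_right 2
    exact Nat.Coprime.mul_right h4 (((Nat.Prime.coprime_iff_not_dvd hq).mpr hqQ₀).pow_right 4)
  obtain ⟨ω₀, d₀, hM, hD, hd₀⟩ := exists_flippedCusp_matrix hcopM
  obtain ⟨y, c, hyc⟩ := exists_unit_solutions (q := q) (Nat.Coprime.isCoprime hcopM) (ω₀ 0 1)
  -- the outputs
  set N : ℕ := 4 * (q * Q₀) ^ 2 * Q₀ ^ 2 * (q ^ 2) ^ 2 with hNdef
  set w : ℚ := (((1 : ℤ) - q * J(-1 | q) : ℤ) : ℚ) with hwdef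
  have hN3 : 3 ≤ N := by
    have : 1 ≤ (q * Q₀) ^ 2 * Q₀ ^ 2 * (q ^ 2) ^ 2 := Nat.one_le_iff_ne_zero.mpr (by positivity)
    rw [hNdef]; nlinarith
  haveI : NeZero N := ⟨by omega⟩
  have hpN : ¬ p ∣ N := by
    have hpq' : Nat.Coprime p q := (Nat.coprime_primes hp hq).mpr hpq
    have hpQ₀' : Nat.Coprime p Q₀ := (Nat.Prime.coprime_iff_not_dvd hp).mpr hpQ₀
    have hp4 : Nat.Coprime p 4 := by
      have : Nat.Coprime p 2 := (Nat.coprime_primes hp Nat.prime_two).mpr (by omega)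
      simpa using this.pow_right 2
    have hcop : Nat.Coprime p N := by
      rw [hNdef]
      exact Nat.Coprime.mul_right (Nat.Coprime.mul_right (Nat.Coprime.mul_right hp4 ((hpq'.mul_right hpQ₀').pow_right 2))
        (hpQ₀'.pow_right 2)) ((hpq'.pow_right 2).pow_right 2)
    exact fun h ↦ hp.one_lt.ne' (Nat.Coprime.eq_one_of_dvd hcop h)
  have hw_int : ¬ (p : ℤ) ∣ (1 : ℤ) - q * J(-1 | q) := by
    intro h; apply hstar
    have : (q : ℤ) * J(-1 | q) - 1 = -((1 : ℤ) - q * J(-1 | q)) := by ring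
    rw [this]; exact h.neg_right
  refine ⟨N, (q * Q₀) ^ 2, Θ, w, hpN, ⟨2 * (q * Q₀) ^ 2 * Q₀ ^ 2 * (q ^ 2) ^ 2, by rw [hNdef]; ring⟩,
    ⟨Q₀ ^ 2, by ring⟩, ?_, hΘ0, ?_, ?_, ?_, ?_⟩
  · -- AWAY is `(qQ₀)²`-periodic
    have := hper.nat_mul (q ^ 2 * Q₀)
    simp only [Nat.cast_id] at this
    rw [show q ^ 2 * Q₀ * Q₀ = (q * Q₀) ^ 2 by ring] at this
    exact this
  · intro j hj
    obtain ⟨m', rfl⟩ := hΘsupp j hj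
    exact ⟨m' ^ 2, rfl⟩
  · rw [hwdef]; exact_mod_cast one_sub_mul_jacobiSym_ne_zero hq.two_le
  · rw [hwdef, padicValRat.of_int, padicValInt.eq_zero_of_not_dvd hw_int]; simp
  -- THE FLIP
  intro hσmem n hqn hq2n hcls
  -- the Legendre twist `V_σ`, its coefficients at every cusp in `p·ℤ̄[1/N]` (NF-Q inside, w3 g19)
  haveI : NeZero (4 * (q * Q₀) ^ 2 * Q₀ ^ 2) := ⟨by positivity⟩
  obtain ⟨V, hV, -, hVcusp⟩ := exists_twist_forall_coeff_slash_mem_nat hKatz g q hq2 hσ (p := p) (N := N)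
    (dvd_refl _) hN3 hc hσmem
  -- `n = q u`, `q ∤ u`, class `J(u|q) = −σ`
  obtain ⟨u, rfl⟩ := hqn
  have hu : ¬ q ∣ u := fun h ↦ hq2n (by rw [pow_two]; exact Nat.mul_dvd_mul_left q h)
  rw [Nat.mul_div_cancel_left u hq.pos] at hcls
  -- the expansion data for (D)
  have hinv' : ∀ γ : SL(2, ℤ), ((4 * Q₀ ^ 4 : ℕ) : ℤ) * (q : ℤ) ^ 2 ∣ γ 1 0 → ((4 * Q₀ ^ 4 : ℕ) : ℤ) ∣ γ 1 1 - 1 →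
      (⇑g) ∣[((k + 1 : ℕ) : ℤ)] γ = ⇑g := by
    intro γ h1 h2; push_cast at h1 h2; exact hinv γ h1 h2
  have h1per : (1 : ℝ) ∈ (Gamma1 (4 * (q * Q₀) ^ 2 * Q₀ ^ 2) : Subgroup (GL (Fin 2) ℝ)).strictPeriods := by
    rw [strictPeriods_Gamma1]; exact AddSubgroup.mem_zmultiples _
  have hF₀ : ∀ τ' : ℍ, HasSum (fun n : ℕ ↦
      (((PowerSeries.coeff n (PowerSeries.mk a * PowerSeries.map (Nat.castRingHom ℚ) Θ)) : ℚ) : ℂ) *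
        Periodic.qParam 1 (τ' : ℂ) ^ n) (g τ') := by
    intro τ'
    have h := UpperHalfPlane.hasSum_qExpansion one_pos (SlashInvariantFormClass.periodic_comp_ofComplex g h1per)
      g.holo' (ModularFormClass.bdd_at_infty g) τ'
    refine h.congr_fun fun n ↦ ?_
    rw [smul_eq_mul, hc n]
  have hH₁ : 0 < 4 * q ^ 3 * Q₀ ^ 4 := by positivity
  have hG : ∀ w' : ℍ, HasSum (fun K : ℕ ↦ (qExpansion N (⇑V ∣[((k + 1 : ℕ) : ℤ)] ω₀)).coeff K *
      Periodic.qParam ((q : ℝ) ^ 3 * (4 * q ^ 3 * Q₀ ^ 4 : ℕ)) (w' : ℂ) ^ K) ((⇑V ∣[((k + 1 : ℕ) : ℤ)] ω₀) w') := by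
    intro w'
    have h := hasSum_qExpansion_slash_of_gamma1 (dvd_refl N) V ω₀ w'
    have hNR : (N : ℝ) = (q : ℝ) ^ 3 * (4 * q ^ 3 * Q₀ ^ 4 : ℕ) := by rw [hNdef]; push_cast; ring
    have hqP : Periodic.qParam (N : ℝ) (w' : ℂ) = Periodic.qParam ((q : ℝ) ^ 3 * (4 * q ^ 3 * Q₀ ^ 4 : ℕ)) (w' : ℂ) := by
      rw [hNR]
    rw [hqP] at h
    refine h.congr_fun fun K ↦ ?_
    rw [smul_eq_mul]
  have hS := fun n' (hn' : ¬ q ∣ n') ↦ flipMoment_cexp_eq_zero_of_not_dvd q hq2 σ ω₀ hM hD y c hyc hn'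
  have hDcoef := coeff_flippedCusp_eq hq ω₀ hM hD hd₀ (⇑g) hinv' _ hF₀ _ (⇑V) hV y c hyc hH₁ _ hG hS u hu
  -- the value of the character sum on the class `−σ`: `(q/2)·(1 − q J(−1|q))`
  rw [flipMoment_cexp_mul_eq q hq2 σ ω₀ hM hD y c hyc hu, one_add_flipWeight_eq q σ u] at hDcoef
  have hσJ : (σ : ℂ) * J((u : ℤ) | q) = -1 := by
    rw [hcls]; push_cast
    rcases hσ with rfl | rfl <;> norm_num
  rw [hσJ] at hDcoef
  -- membership at the cusp `ω₀`, index `u · H₁`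
  obtain ⟨yK, hyK, hcoefK⟩ := hVcusp ω₀ (u * (4 * q ^ 3 * Q₀ ^ 4))
  rw [hDcoef] at hcoefK
  -- read off: `(mk a * Θ)(qu) · w = p · (yK · 2 q^{2k+3})`
  have hqC : (q : ℂ) ≠ 0 := by exact_mod_cast hq0
  refine ⟨yK * (2 * (q : ℂ) ^ (2 * k + 3)), exists_isIntegral_pow_mul_mul hyK
    (by simpa using exists_isIntegral_pow_mul_natCast (N := N) (2 * q ^ (2 * k + 3))), ?_⟩
  have hunit := flipConstant_mul_eq_one hqC k
  rw [hwdef]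
  push_cast
  have key : ((PowerSeries.coeff (q * u) (PowerSeries.mk a * PowerSeries.map (Nat.castRingHom ℚ) Θ) : ℚ) : ℂ) *
      (1 - (q : ℂ) * J(-1 | q)) =
    (((q : ℂ) ^ 2)⁻¹ * ((q : ℂ) ^ 2) ^ (-((k + 1 : ℕ) : ℤ)) *
      ((PowerSeries.coeff (q * u) (PowerSeries.mk a * PowerSeries.map (Nat.castRingHom ℚ) Θ) : ℚ) : ℂ) *
      ((q : ℂ) * (1 + -1 * (J(-1 | q) * q)) / 2)) * (2 * (q : ℂ) ^ (2 * k + 3)) := by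
    have : ((q : ℂ) ^ 2)⁻¹ * ((q : ℂ) ^ 2) ^ (-((k + 1 : ℕ) : ℤ)) *
        ((PowerSeries.coeff (q * u) (PowerSeries.mk a * PowerSeries.map (Nat.castRingHom ℚ) Θ) : ℚ) : ℂ) *
        ((q : ℂ) * (1 + -1 * (J(-1 | q) * q)) / 2) * (2 * (q : ℂ) ^ (2 * k + 3)) =
      (((q : ℂ) ^ 2)⁻¹ * ((q : ℂ) ^ 2) ^ (-((k + 1 : ℕ) : ℤ)) * ((q : ℂ) / 2) * (2 * (q : ℂ) ^ (2 * k + 3))) *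
        (((PowerSeries.coeff (q * u) (PowerSeries.mk a * PowerSeries.map (Nat.castRingHom ℚ) Θ) : ℚ) : ℂ) *
          (1 - (q : ℂ) * J(-1 | q))) := by ring
    rw [this, hunit, one_mul]
  rw [key, hcoefK]
  ring

end Summit.BirchSwinnertonDyer.BirchSwinnertonDyer.Theorems.PrintCFram.FlipRung

end
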